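import Summits.HodgeConjecture.CorCM.GaloisOcticStabiliserLemma
import Literature.AlgebraicGeometry.Pohlmann1968.SimpleCMFourfoldNondegenerate
import Literature.AlgebraicGeometry.Pohlmann1968.CMTypeRankLowerBoundsNumberField
import Literature.AlgebraicGeometry.ComplexMultiplication.SimpleIffPrimitiveCMType
import HarnessLib

/-!
# Simple CM abelian fourfolds whose CM field is GALOIS over `ℚ` are nondegenerate (Ribet; Dodson 1984 §3.3.2,
# the Galois slice) — a classification-free proof — and the Hodge conjecture for all their powers

COR-CM (cell `pub-hodgecm2`), binder seat b04 (gen 13), count-neutral claim GALOIS-OCTIC, part II; sequel of the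
tree's `Literature/AlgebraicGeometry/Pohlmann1968/SimpleCMFourfoldNondegenerate` (Gordon 5.13 / Moonen–Zarhin 2.4 for CM
fourfolds: a PRIMITIVE CM type `Φ` of a CM field `K` of degree `8` is NONDEGENERATE iff `K` contains no quadratic
subfield `k` with a complex place over which `Φ` has multiplicities `(2,2)` — `isNondegenerate_iff_forall_not_weilFibre`)
and of part I `CorCM/GaloisOcticStabiliserLemma` (§1 stabiliser lemma, §2 Galois dictionary).  KERNEL ONLY: theorems,
no definition, no named fact, no `sorry`.  `HC_CM` is not used and not claimed: this is the Hodge conjecture for a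
NAMED SUB-CLASS of CM abelian varieties (simple fourfolds with Galois CM field, and their powers).

## The print

* K. A. Ribet, *Division fields of abelian varieties with complex multiplication* [Ribet1980], Examples (3.7)
  (pp. 87–88): for `d = 4`, `4 ≤ rank(E,S) ≤ 5` "and both possibilities may occur … if `d′ = 3` we have
  `rank(E,S) = 4` … A case-by-case analysis once performed by the author showed that `rank(E,S)` is `5` in all cases
  where `d = 4` and `d′ ≥ 4`.  The tedious proof of this fact has been mislaid."  (`d′` = half the degree of the reflex
  field; for `K/ℚ` Galois and `Φ` primitive the reflex field is `K` itself, `d′ = 4`.)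
* B. Dodson, *The structure of Galois groups of CM-fields* [Dodson1984], §3.3.2 Theorem (p. 16): "Let `A` be a simple
  Abelian variety of CM-type `(K, Φ)`, with `dim A = 4`.  Then `A` is degenerate if and only if
  `Gal(K^c/ℚ) = ℤ₂ × A₄`, or `ℤ₂ × S₄` and `(K, Φ)` is the reflex of a type on a CM-field of degree `6`" (proved
  from the table of the `38` `ρ`-structures for `n = 4`, §5.2).  In particular (`|Gal(K^c/ℚ)| = 8 ∉ {24, 48}`):
  **if the octic CM field `K` is Galois over `ℚ`, every simple abelian fourfold with complex multiplication by `K`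
  is nondegenerate.**
* B. J. J. Moonen, Yu. G. Zarhin [MoonenZarhin1995Duke], Thm. 2.4; B. B. Gordon [Gordon1999HodgeAVSurvey], 5.13 and
  Thm. 6.4 (Hazama): nondegenerate ⟺ `Hdg(Aⁿ) = Div(Aⁿ)` for all `n`.

## What is proved (NEW proof; the print argues by the classification of the Galois groups for `n = 4`)

§3 **`not_isPrimitive_of_fibres_balanced_of_isGalois`**: for `K` Galois CM of degree `8`, a CM type with
   multiplicities `(2,2)` over a quadratic subfield with a complex place is NOT primitive (the stabiliser lemma with
   `G = Gal(K/ℚ)`, `H = Gal(K/k)`, `T = {g | σ_g ∈ Φ}`: `v·T = T` says the translates of `Φ` under `Aut(ℂ)` do not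
   separate `σ_1` from `σ_v`, `isPrimitive_iff_forall_eq`); hence **`isNondegenerate_of_isPrimitive_of_isGalois_eight`**:
   every PRIMITIVE CM type of a GALOIS octic CM field is nondegenerate (Kubota rank `5`,
   `cmTypeRank_eq_five_of_isPrimitive_of_isGalois_eight`), `not_isGalois_of_isPrimitive_of_not_isNondegenerate` /
   `not_isGalois_of_isPrimitive_of_fibres_balanced`: the CM field of a degenerate (Weil-type) simple CM fourfold —
   Mumford–Pohlmann, Moonen–Zarhin case (ii) — is NOT Galois over `ℚ`; and the umbrella
   `isNondegenerate_of_isPrimitive_of_finrank_le_ten`: for CM fields of degree `≤ 10`, Galois-ness is needed only in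
   degree `8` (degrees `≤ 6`: Ribet's `log₂` bound; degree `10 = 2·5`: the prime theorem; tree theorems).
§4 Realisations `(A, ι, θ)` of a CM type of a Galois octic CM field with `A` SIMPLE (⟺ `Φ` primitive, Shimura
   §8.2 Prop. 26, tree `isSimple_iff_isPrimitive`): `Bᵐ(Aⁿ) ⊗ ℂ = Dᵐ(Aⁿ) ⊗ ℂ` on every power, no exceptional Hodge
   class on any power, and **the Hodge conjecture for `A` and for every power `Aⁿ`, UNCONDITIONALLY**
   (`hodgeConjectureFor_pow_of_isSimple_of_isGalois_eight`).  Examples of such `K`: `ℚ(ζ₁₅), ℚ(ζ₁₆), ℚ(ζ₂₀), ℚ(ζ₂₄)`,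
   every cyclic octic CM field, `ℚ(ζ₅, √2)`, `ℚ(√-a, √b, √d)`, the quaternion octic CM fields — all six Galois types
   `ℤ/8, ℤ/4 × ℤ/2 (c square / non-square), (ℤ/2)³, D₄, Q₈` at once, with no case analysis.

NOT here: the converse direction of Dodson's theorem (degenerate simple CM fourfolds exist exactly for the closures
`ℤ₂ × A₄`, `ℤ₂ × S₄`: Mumford's example is the tree's `Pohlmann1968/MumfordSimpleFourfold*`), and the non-Galois
octic fields whose totally real quartic subfield has dihedral closure (also nondegenerate by Dodson's table; not
covered by the stabiliser lemma).
-/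

noncomputable section

open CategoryTheory CategoryTheory.Limits NumberField

namespace Summit.HodgeConjecture.CorCM.GaloisOctic

open Literature.NumberTheory.ComplexMultiplication
open Literature.AlgebraicGeometry.Motives (AbelianVariety CMType)
open Literature.AlgebraicGeometry.Pohlmann1968
open Literature.AlgebraicGeometry.HodgeTheory
open Literature.AlgebraicGeometry.ComplexMultiplication (IsCMTypeRealisation isSimple_iff_isPrimitive)
open Literature.AlgebraicGeometry.VanGeemen1994 (hodgeClassSpan)
open Literature.Barriers.HodgeConjecture (divisorClassesSpan)

open scoped Classical

/-! ## §3 A primitive CM type of a Galois octic CM field has no Weil fibre, hence is nondegenerate -/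

section Main

variable {K : Type} [Field K] [NumberField K] [IsCMField K] {Φ : CMType K}

/-- **A CM type of a GALOIS octic CM field with multiplicities `(2,2)` over a quadratic subfield with a complex
place is NOT primitive.**  With `G = Gal(K/ℚ)`, `H = Gal(K/k)` (order `4`, index `2`), `c` complex conjugation
(central, `c ∉ H`) and `T = {g | σ_g ∈ Φ}`: the fibre of `φ₀|_k` is `{σ_h | h ∈ H}`, so "balanced" says
`|T ∩ H| = 2`, and the stabiliser lemma `GaloisOctic.exists_involution_forall_mem_iff` gives `v ≠ 1` with
`vT = T`; then every translate `τΦ` (`τ ∈ Aut(ℂ)`, acting by `σ_g ↦ σ_{gδ⁻¹}`) contains `σ_1` iff it contains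
`σ_v`, so the translates do not separate the embeddings (`isPrimitive_iff_forall_eq`).  The Galois slice of
[cite: Dodson1984, §3.3.2 Theorem (p. 16)]; cf. [cite: Ribet1980, Examples (3.7) (pp. 87–88)]. -/
theorem not_isPrimitive_of_fibres_balanced_of_isGalois [IsGalois ℚ K] (hK : Module.finrank ℚ K = 8)
    (φ₀ : K →+* ℂ) (k : IntermediateField ℚ K) (hk2 : Module.finrank ℚ k = 2) (τ₀ : k →+* ℂ)
    (hτ₀ : ComplexEmbedding.conjugate τ₀ ≠ τ₀)
    (hbal : ∀ τ : k →+* ℂ, {φ : K →+* ℂ | φ.comp (algebraMap k K) = τ ∧ φ ∈ Φ.1}.ncard =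
      {φ : K →+* ℂ | φ.comp (algebraMap k K) = τ ∧ φ ∉ Φ.1}.ncard) :
    ¬ IsPrimitive (ℂ ≃+* ℂ) Φ.1 φ₀ := by
  haveI := isPretransitive_ringEquiv_complex (K := K)
  set G := K ≃ₐ[ℚ] K
  set c : G := (IsCMField.complexConj K).restrictScalars ℚ with hc_def
  set H : Subgroup G := k.fixingSubgroup with hH_def
  set T : Set G := {g | embOf φ₀ g ∈ Φ.1} with hT_def
  -- `|G| = 8`, `|H| = [K:k] = 4`, index `2`
  have hG : Nat.card G = 8 := by rw [IsGalois.card_aut_eq_finrank, hK]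
  have hKk : Module.finrank k K = 4 := by
    have h := Module.finrank_mul_finrank ℚ k K
    rw [hK, hk2] at h
    omega
  have hH : Nat.card H = 4 := by rw [hH_def, IsGalois.card_fixingSubgroup_eq_finrank k, hKk]
  have hidx : H.index = 2 := by
    have h := H.index_mul_card
    rw [hH, hG] at h
    omega
  have hcH : c ∉ H := complexConj_not_mem_fixingSubgroup k τ₀ hτ₀
  have hT : ∀ g : G, c * g ∈ T ↔ g ∉ T := fun g => embOf_complexConj_mul_mem_iff Φ φ₀ g
  -- the fibre over `φ₀|_k` inside / outside `Φ` is the image of `T ∩ H` / `H ∖ T` under the injection `g ↦ σ_g`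
  have hinj : Function.Injective (embOf φ₀) := (embOf_bijective φ₀).1
  have hfib : ∀ P : (K →+* ℂ) → Prop,
      {φ : K →+* ℂ | φ.comp (algebraMap k K) = φ₀.comp (algebraMap k K) ∧ P φ} =
        embOf φ₀ '' {g : G | g ∈ H ∧ P (embOf φ₀ g)} := by
    intro P
    ext φ
    constructor
    · rintro ⟨hφk, hφ⟩
      obtain ⟨g, rfl⟩ := (embOf_bijective φ₀).2 φ
      exact ⟨g, ⟨(embOf_comp_algebraMap_eq_iff φ₀ k g).1 hφk, hφ⟩, rfl⟩
    · rintro ⟨g, ⟨hg, hP⟩, rfl⟩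
      exact ⟨(embOf_comp_algebraMap_eq_iff φ₀ k g).2 hg, hP⟩
  have hin : {g : G | g ∈ H ∧ embOf φ₀ g ∈ Φ.1}.ncard = {g : G | g ∈ H ∧ embOf φ₀ g ∉ Φ.1}.ncard := by
    have h := hbal (φ₀.comp (algebraMap k K))
    rw [hfib (fun φ => φ ∈ Φ.1), hfib (fun φ => φ ∉ Φ.1), Set.ncard_image_of_injective _ hinj,
      Set.ncard_image_of_injective _ hinj] at h
    exact h
  -- the two parts partition `H` (of size `4`), so each has two elements
  have hunion : {g : G | g ∈ H ∧ embOf φ₀ g ∈ Φ.1} ∪ {g : G | g ∈ H ∧ embOf φ₀ g ∉ Φ.1} = (H : Set G) := by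
    ext g
    simp only [Set.mem_union, Set.mem_setOf_eq, SetLike.mem_coe]
    tauto
  have hdisj : Disjoint {g : G | g ∈ H ∧ embOf φ₀ g ∈ Φ.1} {g : G | g ∈ H ∧ embOf φ₀ g ∉ Φ.1} := by
    rw [Set.disjoint_left]
    rintro g ⟨-, h1⟩ ⟨-, h2⟩
    exact h2 h1
  have hHfin : (H : Set G).Finite := Set.toFinite _
  have hsum := Set.ncard_union_eq hdisj (hHfin.subset (by rw [← hunion]; exact Set.subset_union_left))
    (hHfin.subset (by rw [← hunion]; exact Set.subset_union_right))
  have hHn : (H : Set G).ncard = 4 := by rw [← hH]; exact (Nat.card_coe_set_eq (H : Set G)).symm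
  rw [hunion, hHn, ← hin] at hsum
  have htwo : {g : G | g ∈ H ∧ embOf φ₀ g ∈ Φ.1}.ncard = 2 := by omega
  obtain ⟨x, y, hxy, hS⟩ := Set.ncard_eq_two.1 htwo
  have hx : x ∈ H ∧ embOf φ₀ x ∈ Φ.1 := by
    have : x ∈ ({x, y} : Set G) := Set.mem_insert x {y}
    rw [← hS] at this; exact this
  have hy : y ∈ H ∧ embOf φ₀ y ∈ Φ.1 := by
    have : y ∈ ({x, y} : Set G) := Set.mem_insert_of_mem x rfl
    rw [← hS] at this; exact this
  have hS' : ∀ h : G, h ∈ H → (h ∈ T ↔ h = x ∨ h = y) := by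
    intro h hh
    have : h ∈ T ↔ h ∈ {g : G | g ∈ H ∧ embOf φ₀ g ∈ Φ.1} := by
      simp only [hT_def, Set.mem_setOf_eq]; tauto
    rw [this, hS, Set.mem_insert_iff, Set.mem_singleton_iff]
  -- the stabiliser lemma
  obtain ⟨v, hv1, -, hv⟩ := exists_involution_forall_mem_iff H hH hidx complexConj_mul_self hcH
    complexConj_mul_comm hT hxy hx.1 hy.1 hS'
  -- `σ_1` and `σ_v` are not separated by the translates of `Φ`
  rw [isPrimitive_iff_forall_eq]
  intro hsep
  have hne : embOf φ₀ 1 ≠ embOf φ₀ v := fun h => hv1 (hinj h).symm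
  refine hne (hsep _ _ fun τ => ?_)
  obtain ⟨δ, hδ⟩ := exists_algEquiv_comp_eq_smul φ₀ τ
  rw [smul_embOf_of_comp φ₀ hδ, smul_embOf_of_comp φ₀ hδ, one_mul]
  exact hv δ⁻¹

/-- **Every PRIMITIVE CM type of a GALOIS octic CM field is NONDEGENERATE** (Kubota rank `5 = dim A + 1`;
Gordon 5.13 case (i), `hg = u_K`): by `isNondegenerate_iff_forall_not_weilFibre` a degenerate primitive octic type has
multiplicities `(2,2)` over a quadratic subfield with a complex place, which `not_isPrimitive_of_fibres_balanced_of_isGalois`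
forbids.  This is the Galois slice of Dodson's theorem (a simple CM fourfold is degenerate iff `Gal(K^c/ℚ) ∈
{ℤ₂ × A₄, ℤ₂ × S₄}` and `Φ` is the reflex of a sextic type — impossible when `|Gal(K^c/ℚ)| = 8`) and of Ribet's
"rank `5` whenever `d = 4`, `d′ ≥ 4`" (here the reflex field is `K`, `d′ = 4`), with a classification-free proof.
[cite: Dodson1984, §3.3.2 Theorem (p. 16)] [cite: Ribet1980, Examples (3.7) (pp. 87–88)]
[cite: Gordon1999HodgeAVSurvey, 5.13 (i)] -/
theorem isNondegenerate_of_isPrimitive_of_isGalois_eight [IsGalois ℚ K] (hK : Module.finrank ℚ K = 8)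
    (φ₀ : K →+* ℂ) (hprim : IsPrimitive (ℂ ≃+* ℂ) Φ.1 φ₀) : IsNondegenerate Φ := by
  rw [isNondegenerate_iff_forall_not_weilFibre hK φ₀ hprim]
  intro k hk2 τ₀ hτ₀ hbal
  exact not_isPrimitive_of_fibres_balanced_of_isGalois hK φ₀ k hk2 τ₀ hτ₀ hbal hprim

/-- Rank form: a primitive CM type of a Galois octic CM field has Kubota rank `5` (`= n + 1`, `n = 4`).
[cite: Ribet1980, Examples (3.7) (pp. 87–88)] [cite: Dodson1984, §3.3.2 Theorem (p. 16)] -/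
theorem cmTypeRank_eq_five_of_isPrimitive_of_isGalois_eight [IsGalois ℚ K] (hK : Module.finrank ℚ K = 8)
    (φ₀ : K →+* ℂ) (hprim : IsPrimitive (ℂ ≃+* ℂ) Φ.1 φ₀) : cmTypeRank Φ = 5 := by
  have h := (isNondegenerate_iff Φ).1 (isNondegenerate_of_isPrimitive_of_isGalois_eight hK φ₀ hprim)
  rw [hK] at h
  exact h

/-- **The CM field of a DEGENERATE simple CM fourfold is not Galois over `ℚ`** (contrapositive; e.g. Mumford's
example, `Pohlmann1968/MumfordSimpleFourfold`: its octic field has Galois closure of order `24` or `48`).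
[cite: Dodson1984, §3.3.2 Theorem (p. 16)] -/
theorem not_isGalois_of_isPrimitive_of_not_isNondegenerate (hK : Module.finrank ℚ K = 8) (φ₀ : K →+* ℂ)
    (hprim : IsPrimitive (ℂ ≃+* ℂ) Φ.1 φ₀) (hdeg : ¬ IsNondegenerate Φ) : ¬ IsGalois ℚ K := fun hG => by
  haveI := hG
  exact hdeg (isNondegenerate_of_isPrimitive_of_isGalois_eight hK φ₀ hprim)

/-- **Weil type forces a non-Galois CM field**: if a PRIMITIVE CM type of an octic CM field `K` has multiplicities
`(2,2)` over a quadratic subfield with a complex place (Moonen–Zarhin / Gordon 5.13 case (ii): the simple CM fourfold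
is of Weil type over that imaginary quadratic field), then `K/ℚ` is not Galois.
[cite: Dodson1984, §3.3.2 Theorem (p. 16)] [cite: MoonenZarhin1995Duke, Thm. 2.4] -/
theorem not_isGalois_of_isPrimitive_of_fibres_balanced (hK : Module.finrank ℚ K = 8) (φ₀ : K →+* ℂ)
    (hprim : IsPrimitive (ℂ ≃+* ℂ) Φ.1 φ₀) (k : IntermediateField ℚ K) (hk2 : Module.finrank ℚ k = 2)
    (τ₀ : k →+* ℂ) (hτ₀ : ComplexEmbedding.conjugate τ₀ ≠ τ₀)
    (hbal : ∀ τ : k →+* ℂ, {φ : K →+* ℂ | φ.comp (algebraMap k K) = τ ∧ φ ∈ Φ.1}.ncard =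
      {φ : K →+* ℂ | φ.comp (algebraMap k K) = τ ∧ φ ∉ Φ.1}.ncard) :
    ¬ IsGalois ℚ K := fun hG => by
  haveI := hG
  exact not_isPrimitive_of_fibres_balanced_of_isGalois hK φ₀ k hk2 τ₀ hτ₀ hbal hprim

/-- **Primitive CM types of CM fields of degree `≤ 10` are nondegenerate, Galois-ness being needed only in degree
`8`**: degrees `2, 4, 6` by Ribet's bound `2 + log₂ d ≤ rank ≤ d + 1` (tree
`isNondegenerate_of_isPrimitive_of_finrank_le_six`), degree `10 = 2·5` by the prime theorem (Ribet–Tankeev–Yanai, tree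
`isNondegenerate_of_isPrimitive_of_prime`), degree `8` by `isNondegenerate_of_isPrimitive_of_isGalois_eight` under the
hypothesis that `K/ℚ` is Galois (necessary: Mumford's degenerate simple CM fourfold).  A CM field has even degree
(`[K:K⁺] = 2`). [cite: Ribet1980, Examples (3.7) (pp. 87–88)] [cite: Dodson1984, §3.3.2 Theorem (p. 16)] -/
theorem isNondegenerate_of_isPrimitive_of_finrank_le_ten (hK : Module.finrank ℚ K ≤ 10)
    (hGal : Module.finrank ℚ K = 8 → IsGalois ℚ K) (φ₀ : K →+* ℂ) (hprim : IsPrimitive (ℂ ≃+* ℂ) Φ.1 φ₀) :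
    IsNondegenerate Φ := by
  have heven : Module.finrank ℚ K = Module.finrank ℚ (maximalRealSubfield K) * 2 := by
    rw [← Algebra.IsQuadraticExtension.finrank_eq_two (maximalRealSubfield K) K, Module.finrank_mul_finrank]
  by_cases h6 : Module.finrank ℚ K ≤ 6
  · exact isNondegenerate_of_isPrimitive_of_finrank_le_six (Φ := Φ) h6 φ₀ hprim
  by_cases h8 : Module.finrank ℚ K = 8
  · haveI := hGal h8
    exact isNondegenerate_of_isPrimitive_of_isGalois_eight h8 φ₀ hprim
  · have h10 : Module.finrank ℚ K = 2 * 5 := by omega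
    exact isNondegenerate_of_isPrimitive_of_prime (Φ := Φ) (by norm_num) h10 φ₀ hprim

end Main

/-! ## §4 Realisations: the Hodge conjecture for every power of a simple CM abelian fourfold with Galois CM field -/

section Geometry

variable {K : Type} [Field K] [NumberField K] [IsCMField K] [IsGalois ℚ K] {Φ : CMType K}
variable {A : AbelianVariety ℂ} {ι : 𝓞 K →+* End A} {θ : K →+* Module.End ℂ (complexBetti A.X 1)}

/-- **A SIMPLE abelian fourfold with complex multiplication by a Galois CM field realises a nondegenerate type**
(`A` simple ⟺ `Φ` primitive, Shimura §8.2 Prop. 26 — tree `isSimple_iff_isPrimitive`).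
[cite: Dodson1984, §3.3.2 Theorem (p. 16)] [cite: Shimura1998, §8.2 Prop. 26] -/
theorem isNondegenerate_of_isSimple_of_isGalois_eight (hK : Module.finrank ℚ K = 8)
    (hA : IsCMTypeRealisation Φ A ι θ) (hs : A.IsSimple) : IsNondegenerate Φ := by
  obtain ⟨φ₀⟩ := (inferInstance : Nonempty (K →+* ℂ))
  exact isNondegenerate_of_isPrimitive_of_isGalois_eight hK φ₀ ((isSimple_iff_isPrimitive hA φ₀).1 hs)

/-- **`Bᵐ(Aⁿ) ⊗ ℂ = Dᵐ(Aⁿ) ⊗ ℂ` on every power of a simple abelian fourfold with CM by a Galois CM field**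
(`Hdg(Aⁿ) = Div(Aⁿ)` for all `n`, Gordon 5.13 (i) / Hazama 6.4). [cite: Gordon1999HodgeAVSurvey, 5.13 (i) and Thm. 6.4] -/
theorem hodgeClassSpan_pow_eq_divisorClassesSpan_of_isSimple_of_isGalois_eight (hK : Module.finrank ℚ K = 8)
    (hA : IsCMTypeRealisation Φ A ι θ) (hs : A.IsSimple) (n m : ℕ) :
    hodgeClassSpan (⨁ fun _ : Fin n => A).dim (⨁ fun _ : Fin n => A).X m =
      divisorClassesSpan (⨁ fun _ : Fin n => A).X (⨁ fun _ : Fin n => A).dim m :=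
  (isNondegenerate_of_isSimple_of_isGalois_eight hK hA hs).hodgeClassSpan_pow_eq_divisorClassesSpan hA n m

/-- **No power of a simple abelian fourfold with CM by a Galois CM field carries an exceptional Hodge class**:
every rational `(m,m)`-class on `Aⁿ` is a polynomial in divisor classes. [cite: Gordon1999HodgeAVSurvey, 5.13 (i) and Thm. 6.4] -/
theorem mem_divisorClassesSpan_pow_of_isSimple_of_isGalois_eight (hK : Module.finrank ℚ K = 8)
    (hA : IsCMTypeRealisation Φ A ι θ) (hs : A.IsSimple) (n m : ℕ)
    {c : complexBetti (⨁ fun _ : Fin n => A).X (2 * m)} (hcQ : IsRationalClass c)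
    (hcH : IsOfHodgeType (⨁ fun _ : Fin n => A).dim (⨁ fun _ : Fin n => A).X (2 * m) m m c) :
    c ∈ divisorClassesSpan (⨁ fun _ : Fin n => A).X (⨁ fun _ : Fin n => A).dim m :=
  (isNondegenerate_of_isSimple_of_isGalois_eight hK hA hs).mem_divisorClassesSpan_pow hA n m hcQ hcH

/-- **THE HODGE CONJECTURE FOR EVERY POWER `Aⁿ` OF EVERY SIMPLE ABELIAN FOURFOLD WITH COMPLEX MULTIPLICATION BY A
GALOIS CM FIELD — UNCONDITIONALLY** (no named fact: Lefschetz (1,1) and cup products, Hazama–Murty via nondegeneracy).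
Covers at once the cyclotomic `ℚ(ζ₁₅), ℚ(ζ₁₆), ℚ(ζ₂₀), ℚ(ζ₂₄)`, every cyclic, `ℤ/4 × ℤ/2`, triquadratic and
quaternion octic CM field. [cite: Dodson1984, §3.3.2 Theorem (p. 16)] [cite: Gordon1999HodgeAVSurvey, 5.13 (i) and Thm. 6.4] -/
theorem hodgeConjectureFor_pow_of_isSimple_of_isGalois_eight (hK : Module.finrank ℚ K = 8)
    (hA : IsCMTypeRealisation Φ A ι θ) (hs : A.IsSimple) (n : ℕ) :
    HodgeConjectureFor (⨁ fun _ : Fin n => A).dim (⨁ fun _ : Fin n => A).X :=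
  (isNondegenerate_of_isSimple_of_isGalois_eight hK hA hs).hodgeConjectureFor_pow hA n

/-- **The Hodge conjecture for every simple abelian fourfold with complex multiplication by a Galois CM field**
(the variety itself, `HodgeConjectureFor A.dim A.X`) — UNCONDITIONALLY. [cite: Dodson1984, §3.3.2 Theorem (p. 16)]
[cite: Gordon1999HodgeAVSurvey, 5.13 (i)] -/
theorem hodgeConjectureFor_of_isSimple_of_isGalois_eight (hK : Module.finrank ℚ K = 8)
    (hA : IsCMTypeRealisation Φ A ι θ) (hs : A.IsSimple) : HodgeConjectureFor A.dim A.X :=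
  (isNondegenerate_of_isSimple_of_isGalois_eight hK hA hs).hodgeConjectureFor hA

end Geometry

end Summit.HodgeConjecture.CorCM.GaloisOctic

end
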